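import Summits.Ventures.QEC.Census.IPBounds.CRSSSpecialBounds
import Summits.Ventures.QEC.Census.IPBounds.Beta15_4
import Summits.Ventures.QEC.Census.IPBounds.Beta16_8
import HarnessLib

/-!
# All nine special upper bounds (`β`) of CRSS Table III are kernel theorems: the named fact discharged

Venture QEC (cell `qec`), row 06 / rung X1. `Literature/InformationTheory/QuantumCodes/CRSSSpecialUpperBounds.lean`
(qec-lit-1, p495668) records Calderbank–Rains–Shor–Sloane's nine «special upper bounds» [CalderbankEtAl1998, §7 (i)–(iii)
and Table III note β] as ONE named fact `CRSS1998_section7_specialBounds` (tier CITED); `IPBounds/CRSSSpecialBounds.lean`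
(p526525) reduced it to the two conjuncts `¬[[16,8,4]]`, `¬[[15,4,5]]`. Both are now kernel theorems:
`noCodeBeta_15_4` (`IPBounds/Beta15_4.lean`: CRSS's two-stage argument with the refined system of the pair
`(C, C′)`) and `noCodeBeta_16_8` (`IPBounds/Beta16_8.lean`: the same strengthened by two subgroup orders and the
`GF(2)` quadratic-form zero count of the refined distribution). Hence the named fact HOLDS unconditionally
(`CRSS1998_section7_specialBounds_holds`), and the nine cells are available in the table's `∀ d ≥ d₀` form.
HONEST FRAMING: nonexistence (upper bounds on `d`) only; no distance of any code is certified here.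
[cite: CalderbankEtAl1998, §7 (i)–(iii) (printed p. 28) and §8 Table III note β (printed pp. 30–33)]
-/

namespace Summit.Ventures.QEC.Census

open Literature.InformationTheory.QuantumCodes

/-- **CRSS's nine special upper bounds — the named fact `CRSS1998_section7_specialBounds` DISCHARGED**: no
`[[7,0,4]]`, `[[13,0,6]]`, `[[15,4,5]]`, `[[15,7,4]]`, `[[16,8,4]]`, `[[18,12,3]]`, `[[19,13,3]]`, `[[22,14,4]]`,
`[[25,0,10]]` additive code. (proved, KERNEL, unconditional)
[cite: CalderbankEtAl1998, §7 (i)–(iii) (printed p. 28) and §8 Table III (printed pp. 32–33)] -/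
theorem CRSS1998_section7_specialBounds_holds : CRSS1998_section7_specialBounds :=
  CRSS1998_section7_specialBounds_of noCodeBeta_16_8 noCodeBeta_15_4

/-- The nine β bounds as an explicit conjunction of kernel theorems (same content as the named fact, spelled out).
(proved, KERNEL, unconditional) [cite: CalderbankEtAl1998, §7 (iii) (printed p. 28) and §8 Table III (printed pp. 32–33)] -/
theorem CRSS1998_section7_nineSpecialBounds :
    ¬ AdditiveCodeExists 7 0 4 ∧ ¬ AdditiveCodeExists 13 0 6 ∧ ¬ AdditiveCodeExists 15 4 5 ∧
      ¬ AdditiveCodeExists 15 7 4 ∧ ¬ AdditiveCodeExists 16 8 4 ∧ ¬ AdditiveCodeExists 18 12 3 ∧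
      ¬ AdditiveCodeExists 19 13 3 ∧ ¬ AdditiveCodeExists 22 14 4 ∧ ¬ AdditiveCodeExists 25 0 10 :=
  ⟨noCodeBeta_7_0, noCodeBeta_13_0, noCodeBeta_15_4, noCodeBeta_15_7, noCodeBeta_16_8, Bierbrauer2016_no_18_12_3,
    Bierbrauer2016_no_19_13_3, noCodeBeta_22_14, noCodeBeta_25_0⟩

/-- The two cells settled last, in the table's `∀ d ≥ d₀` form: no `[[15,4,d]]` for `d ≥ 5` and no `[[16,8,d]]` for
`d ≥ 4`. (proved, KERNEL, unconditional) [cite: CalderbankEtAl1998, §8 Table III note β, entries (15,4), (16,8) (printed pp. 30–33)] -/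
theorem noCodeBeta_of_le' :
    (∀ d, 5 ≤ d → ¬ AdditiveCodeExists 15 4 d) ∧ (∀ d, 4 ≤ d → ¬ AdditiveCodeExists 16 8 d) :=
  ⟨fun _ hd => CRSS1998_section7_specialBounds.not_exists_of_le noCodeBeta_15_4 hd,
    fun _ hd => CRSS1998_section7_specialBounds.not_exists_of_le noCodeBeta_16_8 hd⟩

end Summit.Ventures.QEC.Census
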